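import Literature.NumberTheory.Transcendental.MonomialFibreDimension
import Literature.NumberTheory.Transcendental.GammaLocusSlices
import HarnessLib

/-!
# Bays–Kirby 2018, Prop. 11.5 (GΓC ⟹ GSΓC over `K`) from the horizontal weak Zilber–Pink theorem

M. Bays, J. Kirby, *Pseudo-exponential maps, variants, and quasiminimality*, Algebra & Number
Theory 12 (2018) 493–549, Prop. 11.5 (exponential case): for a full Γ-field `F` and a Γ-closed
`K ◁_cl F`, generic Γ-closedness over `K` implies generic strong Γ-closedness over `K`
(Def. 11.1; `GammaField.IsGenericallyGammaClosedOver`,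
`GammaField.IsGenericallyStronglyGammaClosedOver`). The named fact
`Literature.NumberTheory.Transcendental.BaysKirby2018_prop_11_5` (`ZilberGenericClosedness.lean`)
is here REDUCED to its single deep input, the horizontal semiabelian weak Zilber–Pink theorem
(Thm 11.4, from the uniform weak CIT, Fact 11.3: Zilber 2002; Kirby 2009, Thm 4.6), which enters as
an explicit hypothesis in the form "for every Zariski closed `W ⊆ F^{N ⊕ N}` there is a finite set
`𝓗` of integer matrices with `WeakZPBound F N W 𝓗`" (`GammaLocusSlices.lean`); everything else in
the printed proof is proved:

* `GammaField.exists_mem_aeval_matrixAct_eq_zero` — the core of the proof for one pair `(V, α)`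
  and one dependent Γ-point `γ ∈ V`: with `M` the relation matrix of `ζ = (α, γ)` over `K`, the
  `F`-component through `ζ` of the `K₀`-locus of `ζ` is an atypical component of
  `U_{M, Mζ₁} ∩ (𝔾ₐ × ζ₂·(ker M)°)` (displays (11.1)–(11.3)); the bound yields `H ∈ 𝓗` whose coset
  equations are relations of `ζ` over `K` (Γ-closedness of `K`; so `[H] ζ` is `K₀`-rational and
  the slice-coset intersection lies in the fibre of `[H]` through `ζ`), and strong rotundity
  `dim [H] W > rk H` with display (11.4) contradicts the fibre-dimension theorem
  (`MonomialFibre.exists_fibre_dimension_bound`) unless `ζ` lies in the bad locus `W_H`;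
* `GammaField.exists_gammaPt_linIndepOver_of_weakZPBound` — Prop. 11.5 for one pair `(V, α)`:
  `α` being generic in the projection of `W`, each `W_H` cuts `V` in a proper closed
  `V_{H,α} = {f_H = 0}`, and Zariski density of the Γ-points of `V` (GΓC) gives a Γ-point off
  `⋃_{H ∈ 𝓗} V_{H,α}`, hence independent over `Γ(K) ∪ α`;
* `GammaField.isGenericallyStronglyGammaClosedOver_of_weakZP` — GΓC over `K` ⟹ GSΓC over `K`;
* `BaysKirby2018_prop_11_5_of_weakZP` — the named fact from the weak Zilber–Pink hypothesis.

Not needed from the hypotheses of Prop. 11.5: `K ≠ F` and the surjectivity of `exp` (the coset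
equations of `H` are shown to be relations of `ζ` over `K` by Γ-closedness alone,
`GammaField.IsGammaClosed.mem_of_exp_mem_acl`); `V` multiplicatively free and rotund are not used
either (they are hypotheses of GΓC, passed through).

## What is NOT here

Theorem 11.4 / Fact 11.3 themselves (uniform Ax–Schanuel plus definability of dimension and
irreducibility in families — a theory of its own). Once Thm 11.4 is available in the form of the
hypothesis of `BaysKirby2018_prop_11_5_of_weakZP`, the discharge
`BaysKirby2018_prop_11_5_holds` is one line.

## References

* M. Bays, J. Kirby, *Pseudo-exponential maps, variants, and quasiminimality*, Algebra & Number
  Theory 12 (2018) 493–549: Lemma 2.1, Def. 11.1, Fact 11.3, Thm 11.4, Prop. 11.5.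
* B. Zilber, *Exponential sums equations and the Schanuel conjecture*, J. LMS 65 (2002) (weak CIT).
* J. Kirby, *The theory of the exponential differential equations of semiabelian varieties*,
  Selecta Math. 15 (2009), Thm 4.6.
-/

noncomputable section

open Set MvPolynomial

universe u

namespace Literature.NumberTheory.Transcendental

namespace GammaField

open Literature.ModelTheory.ExponentialFields.ExponentialRing ZilberGSGC ZilberSaturationMain

/-! ### Saturated relations -/

section RowSat

variable {F : Type u} [Field F] {N : ℕ}

variable [CharZero F]

/-- **Saturated row vectors of a relation matrix are relations**: if the rows of `M` are
`ℚ`-linear relations of `ζ` modulo the `ℚ`-subspace `Λ`, so is every integer vector a non-zero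
multiple of which lies in the row lattice. [folklore] -/
theorem sum_mul_mem_of_mem_rowSat (Λ : Submodule ℚ F) {M : Matrix (Fin N) (Fin N) ℤ} {ζ : Fin N → F}
    (hrel : ∀ i, ∑ j, (M i j : F) * ζ j ∈ Λ) {m : Fin N → ℤ} (hm : m ∈ rowSat N M) :
    ∑ j, (m j : F) * ζ j ∈ Λ := by
  obtain ⟨d, hd0, hdm⟩ := hm
  -- the additive evaluation `v ↦ ∑ vⱼ ζⱼ`
  let L : (Fin N → ℤ) →+ F :=
    { toFun := fun v => ∑ j, (v j : F) * ζ j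
      map_zero' := by simp
      map_add' := fun v w => by
        simp only [Pi.add_apply, Int.cast_add, add_mul, Finset.sum_add_distrib] }
  have hL : ∀ v ∈ Submodule.span ℤ (Set.range fun i : Fin N => M i), L v ∈ Λ := by
    intro v hv
    refine Submodule.span_induction ?_ ?_ ?_ ?_ hv
    · rintro _ ⟨i, rfl⟩; exact hrel i
    · rw [map_zero]; exact Λ.zero_mem
    · intro x y _ _ hx hy; rw [map_add]; exact Λ.add_mem hx hy
    · intro c x _ hx
      rw [map_zsmul]
      have : (c : ℤ) • L x = (c : ℚ) • L x := by rw [Int.cast_smul_eq_zsmul]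
      rw [this]
      exact Λ.smul_mem _ hx
  have h1 : L (d • m) = (d : ℚ) • L m := by
    rw [map_zsmul, Int.cast_smul_eq_zsmul]
  have h2 : (d : ℚ) • L m ∈ Λ := h1 ▸ hL _ hdm
  have h3 := Λ.smul_mem (d : ℚ)⁻¹ h2
  rwa [smul_smul, inv_mul_cancel₀ (by exact_mod_cast hd0 : (d : ℚ) ≠ 0), one_smul] at h3

end RowSat

/-! ### The core of Prop. 11.5: a dependent Γ-point of `V` lies in one of the bad loci -/

section Core

variable {F : Type u} [Field F] [CharZero F] [Literature.ModelTheory.ExponentialFields.ExponentialRing F]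
  [IsAlgClosed F]

attribute [local instance] MvPolynomial.algebraMvPolynomial

omit [CharZero F] [IsAlgClosed F] in
/-- `∏ (exp xⱼ)^{mⱼ} = exp (∑ mⱼ xⱼ)` on the coordinates of `(x, exp x)`. [folklore] -/
theorem prod_gammaPt_inr_zpow {N : ℕ} (x : Fin N → F) (m : Fin N → ℤ) :
    ∏ j, gammaPt x (Sum.inr j) ^ m j = exp (∑ j, (m j : F) * gammaPt x (Sum.inl j)) := by
  rw [exp_sum_intCast_mul]
  rfl

set_option maxHeartbeats 1600000 in
/-- **The core of Bays–Kirby's proof of Prop. 11.5** (exponential case, over a Γ-closed `K`, with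
the weak Zilber–Pink bound as a hypothesis). In the situation of Def. 11.1 (`V = W₀ ∩ Gⁿ`
irreducible of dimension `n`, additively free, defined over `K(α)`, `α = (a, exp a)` independent
over `Γ(K)`, `K + ℚa ◁ F`, `W = Loc(α, V/K)` strongly rotund), suppose the finite set `𝓗` of integer
matrices controls the atypical components of the linear slices of `W` (`WeakZPBound`, the
conclusion of Thm 11.4), and let `h_H` (`H ∈ Mat`) be polynomials over `K₀` with the fibre-dimension
property of `MonomialFibre.exists_fibre_dimension_bound` for `[H]` on `W ∩ G^{r+n}`. Then for every
Γ-point `γ = (g, exp g) ∈ V` with `g` linearly *dependent* over `K + ℚa` there is `H ∈ 𝓗` with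
`h_H([H](α, γ)) = 0`. (Proof of Prop. 11.5: the relation matrix `M` of `ζ = (α, γ)` over `K`
defines the slice `U_{M, Mζ₁}` and the coset `ζ₂·(ker M)°`; the `F`-component through `ζ` of the
`K₀`-locus of `ζ` is an atypical component of their intersection (displays (11.1)–(11.3): its
dimension is `td(ζ/K₀) ≥ td(α/K₀) + n - rk M`, while `dim U < dim W ≤ td(α/K₀) + n`); the bound
gives `H ∈ 𝓗` whose coset equations, being constant on a `K₀`-variety, are relations of `ζ` over
`K` (Γ-closedness), so that `[H] ζ` is `K₀`-rational and `U ∩ (𝔾ₐ × ζ₂·(ker H)°)` lies in the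
fibre of `[H]` through `ζ`; strong rotundity `dim [H] W > rk H` and display (11.4) then contradict
the fibre-dimension bound unless `h_H([H] ζ) = 0`.)
[cite: BaysKirby2018ANT, Prop. 11.5 (proof)] -/
theorem exists_mem_aeval_matrixAct_eq_zero {K : Submodule ℚ F} (hK : IsGammaClosed K)
    {n r : ℕ} {W₀ : Set (Fin n ⊕ Fin n → F)} {a : Fin r → F}
    (hirr : IsIrreducibleClosed F W₀) (hne : (W₀ ∩ torusLocus F n).Nonempty)
    (hdim : zariskiDim F W₀ = n) (hadd : IsAddFree F n (W₀ ∩ torusLocus F n))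
    (ha : LinIndepOver K a) (hX : IsStrong (K ⊔ Submodule.span ℚ (range a)))
    (hdef : IsDefinedOver (adjoinPt K a) W₀)
    (hsrot : IsStronglyRotund F (r + n)
      (locOver K (gammaPt a) (W₀ ∩ torusLocus F n) ∩ torusLocus F (r + n)))
    {𝓗 : Finset (Matrix (Fin (r + n)) (Fin (r + n)) ℤ)}
    (h𝓗 : WeakZPBound F (r + n) (locOver K (gammaPt a) (W₀ ∩ torusLocus F n)) 𝓗)
    (hh : Matrix (Fin (r + n)) (Fin (r + n)) ℤ →
      MvPolynomial (Fin (r + n) ⊕ Fin (r + n)) (fieldOf K).toSubfield)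
    (hfib : ∀ (MH : Matrix (Fin (r + n)) (Fin (r + n)) ℤ),
      ∀ z ∈ zeroLocus F (kLocIdeal K a W₀) ∩ torusLocus F (r + n),
        (∀ j, matrixAct MH z j ∈ Set.range (algebraMap (fieldOf K).toSubfield F)) →
        aeval (matrixAct MH z) (hh MH) ≠ 0 →
        zariskiDim F {w | w ∈ zeroLocus F (kLocIdeal K a W₀) ∩ torusLocus F (r + n) ∧
            matrixAct MH w = matrixAct MH z} +
          zariskiDim F (matrixAct MH '' (zeroLocus F (kLocIdeal K a W₀) ∩ torusLocus F (r + n))) ≤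
        ringKrullDim (MvPolynomial (Fin (r + n) ⊕ Fin (r + n)) (fieldOf K).toSubfield ⧸
          kLocIdeal K a W₀))
    {g : Fin n → F} (hgW : gammaPt g ∈ W₀)
    (hdep : ¬ LinIndepOver (K ⊔ Submodule.span ℚ (range a)) g) :
    ∃ MH ∈ 𝓗, aeval (matrixAct MH (gammaPt (Fin.append a g))) (hh MH) = 0 := by
  classical
  -- notation
  set K₀ : Subfield F := (fieldOf K).toSubfield with hK₀
  have hK₀coe : (K₀ : Set F) = (fieldOf K : Set F) := rfl
  haveI hK₀ac : IsAlgClosed K₀ := hK.isAlgClosed_fieldOf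
  set Xs : Submodule ℚ F := K ⊔ Submodule.span ℚ (range a) with hXs
  set V : Set (Fin n ⊕ Fin n → F) := W₀ ∩ torusLocus F n with hV
  set Sa : Set F := range (gammaPt a) with hSa
  set 𝔭 := kLocIdeal K a W₀ with h𝔭def
  haveI h𝔭 : 𝔭.IsPrime := isPrime_kLocIdeal hirr hne
  set W : Set (Fin (r + n) ⊕ Fin (r + n) → F) := locOver K (gammaPt a) V with hWdef
  have hW𝔭 : W = zeroLocus F 𝔭 := rfl
  /- the relation matrix `M` of `ζ₁ = (a, g)` over `K` -/
  obtain ⟨s, M, hrank, hrel, hldimζ⟩ := exists_relation_matrix K (Fin.append a g)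
  have hspanζ : K ⊔ Submodule.span ℚ (range (Fin.append a g)) = Xs ⊔ Submodule.span ℚ (range g) := by
    rw [span_range_append, ← sup_assoc]
  have hfgζ : IsFG K (Xs ⊔ Submodule.span ℚ (range g)) := by
    rw [← hspanζ, isFG_sup_left]
    exact isFG_span_of_finite K (finite_range _)
  have hldim1 : ldim K (Submodule.span ℚ (range (Fin.append a g))) =
      r + ldim Xs (Submodule.span ℚ (range g)) := by
    rw [← ldim_sup_left K, hspanζ, ldim_add (le_sup_left : K ≤ Xs) le_sup_left hfgζ, ldim_sup_left,
      hXs, ldim_sup_left, ldim_span_eq_of_linIndepOver ha]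
  have hlt : ldim Xs (Submodule.span ℚ (range g)) < n := ldim_lt_of_not_linIndepOver hdep
  have hldimg : ldim Xs (Submodule.span ℚ (range g)) + s = n := by omega
  have hs1 : 1 ≤ s := by omega
  have hM0 : M ≠ 0 := by
    rintro rfl
    rw [Matrix.map_zero (Int.cast : ℤ → ℚ) Int.cast_zero, Matrix.rank_zero] at hrank
    omega
  /- the point `ζ = (α, γ)` -/
  set ζ : Fin (r + n) ⊕ Fin (r + n) → F := gammaPt (Fin.append a g) with hζdef
  have hζprod : prodPt (gammaPt a) (gammaPt g) = ζ := prodPt_gammaPt a g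
  have hgV : gammaPt g ∈ V := ⟨hgW, gammaPt_mem_torusLocus g⟩
  have hζW : ζ ∈ zeroLocus F 𝔭 := by
    rw [← hW𝔭, ← hζprod]; exact prodPt_mem_locOver K (gammaPt a) hgV
  have hζT : ζ ∈ torusLocus F (r + n) := gammaPt_mem_torusLocus _
  have hζ1 : ∀ j, ζ (Sum.inl j) = Fin.append a g j := fun j => rfl
  /- the slice `U = W ∩ {M x = M ζ₁}` -/
  have hkvK : ∀ i, ∑ j, (M i j : F) * ζ (Sum.inl j) ∈ K := hrel
  let kv : Fin (r + n) → K₀ := fun i => ⟨∑ j, (M i j : F) * ζ (Sum.inl j), mem_fieldOf_of_mem (hkvK i)⟩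
  set A : Matrix (Fin (r + n)) (Fin (r + n)) F := M.map (Int.cast : ℤ → F) with hA
  have hAmul : ∀ (z : Fin (r + n) ⊕ Fin (r + n) → F) (i : Fin (r + n)),
      A.mulVec (z ∘ Sum.inl) i = ∑ j, (M i j : F) * z (Sum.inl j) := by
    intro z i
    simp [hA, Matrix.mulVec, dotProduct, Matrix.map_apply, Function.comp_apply]
  have hAζ : A.mulVec (ζ ∘ Sum.inl) = fun i => (kv i : F) := funext fun i => hAmul ζ i
  have hζslice : ζ ∈ linSlice (r + n) F W A (fun i => (kv i : F)) := ⟨hζW, hζT, hAζ⟩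
  /- the point ideal `𝔯 = I_{K₀}(ζ)` and the `F`-component of its zero set through `ζ` -/
  set 𝔯 : Ideal (MvPolynomial (Fin (r + n) ⊕ Fin (r + n)) K₀) :=
    vanishingIdeal K₀ ({ζ} : Set (Fin (r + n) ⊕ Fin (r + n) → F)) with h𝔯def
  have hmem𝔯 : ∀ f, f ∈ 𝔯 ↔ aeval ζ f = 0 := fun f => by
    rw [h𝔯def, mem_vanishingIdeal_singleton_iff]
  have h𝔯ker : 𝔯 = RingHom.ker (aeval ζ : MvPolynomial _ K₀ →ₐ[K₀] F) := by
    ext f; rw [hmem𝔯, RingHom.mem_ker]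
  haveI h𝔯p : 𝔯.IsPrime := by rw [h𝔯ker]; exact RingHom.ker_isPrime _
  have h𝔭𝔯 : 𝔭 ≤ 𝔯 := fun f hf => (hmem𝔯 f).2 ((mem_zeroLocus_iff.1 hζW) f hf)
  have hY𝔯 : ∀ i, (X (Sum.inr i) : MvPolynomial (Fin (r + n) ⊕ Fin (r + n)) K₀) ∉ 𝔯 := by
    intro i h
    rw [hmem𝔯, aeval_X] at h
    exact hζT i h
  have hIζ : vanishingIdeal F ({ζ} : Set (Fin (r + n) ⊕ Fin (r + n) → F)) =
      RingHom.ker (aeval ζ : MvPolynomial _ F →ₐ[F] F) := by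
    ext f; rw [mem_vanishingIdeal_singleton_iff, RingHom.mem_ker]
  haveI : (vanishingIdeal F ({ζ} : Set (Fin (r + n) ⊕ Fin (r + n) → F))).IsPrime := by
    rw [hIζ]; exact RingHom.ker_isPrime _
  have hle : 𝔯.map (algebraMap (MvPolynomial (Fin (r + n) ⊕ Fin (r + n)) K₀)
      (MvPolynomial (Fin (r + n) ⊕ Fin (r + n)) F)) ≤
        vanishingIdeal F ({ζ} : Set (Fin (r + n) ⊕ Fin (r + n) → F)) := by
    rw [Ideal.map_le_iff_le_comap]
    intro f hf
    rw [Ideal.mem_comap, mem_vanishingIdeal_singleton_iff, MvPolynomial.algebraMap_def,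
      aeval_map_algebraMap]
    exact (hmem𝔯 f).1 hf
  obtain ⟨Q, hQ, hQle⟩ := Ideal.exists_minimalPrimes_le hle
  haveI hQp : Q.IsPrime := hQ.1.1
  have hζQ : ζ ∈ zeroLocus F Q := by
    rw [mem_zeroLocus_iff]
    intro f hf
    exact (mem_vanishingIdeal_singleton_iff _ _).1 (hQle hf)
  set Xc : Set (Fin (r + n) ⊕ Fin (r + n) → F) := zeroLocus F Q with hXc
  set X₁ : Set (Fin (r + n) ⊕ Fin (r + n) → F) := Xc ∩ torusLocus F (r + n) with hX₁
  have hζX₁ : ζ ∈ X₁ := ⟨hζQ, hζT⟩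
  have hXirr : IsIrreducibleInG F (r + n) X₁ :=
    ⟨Xc, isIrreducibleClosed_zeroLocus Q, rfl, ⟨ζ, hζX₁⟩⟩
  have hXc𝔯 : ∀ z ∈ Xc, ∀ f ∈ 𝔯, aeval z f = 0 := fun z hz f hf =>
    (mem_zeroLocus_iff.1 (LocusComponents.zeroLocus_subset_zeroLocus hQ hz)) f hf
  /- `X₁ ⊆ U` -/
  have hXslice : X₁ ⊆ linSlice (r + n) F W A (fun i => (kv i : F)) := by
    rintro z ⟨hz, hzT⟩
    refine ⟨?_, hzT, ?_⟩
    · rw [hW𝔭, mem_zeroLocus_iff]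
      exact fun f hf => hXc𝔯 z hz f (h𝔭𝔯 hf)
    · funext i
      have h0 := hXc𝔯 z hz (rowForm K₀ M kv i) (by
        rw [hmem𝔯, aeval_rowForm]
        exact sub_self _)
      rw [aeval_rowForm, sub_eq_zero] at h0
      rw [hAmul]; exact h0
  /- `X₁ ⊆ 𝔾ₐ × ζ₂·(ker M)°` -/
  have hXcoset : X₁ ⊆ cosetU (r + n) F (ζ ∘ Sum.inr) M := by
    rintro z ⟨hz, hzT⟩
    refine ⟨hzT, fun m hm => ?_⟩
    have hmK : ∑ j, (m j : F) * ζ (Sum.inl j) ∈ K := sum_mul_mem_of_mem_rowSat K hrel hm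
    have hu : ∏ j, ζ (Sum.inr j) ^ m j = exp (∑ j, (m j : F) * ζ (Sum.inl j)) :=
      prod_gammaPt_inr_zpow _ _
    have huK₀ : ∏ j, ζ (Sum.inr j) ^ m j ∈ K₀ := by rw [hu]; exact exp_mem_fieldOf hmK
    have h0 := hXc𝔯 z hz (binomialK K₀ ⟨_, huK₀⟩ m) (by
      rw [hmem𝔯, aeval_binomialK_eq_zero_iff K₀ _ m hζT])
    rw [aeval_binomialK_eq_zero_iff K₀ _ m hzT] at h0
    exact (prod_div_zpow_eq_one_iff_prod_eq (fun i => hζT i) m).2 h0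
  /- the irreducible component `X'` of `U ∩ (𝔾ₐ × ζ₂·(ker M)°)` through `X₁` -/
  have hWclosed : IsZariskiClosed F W := (isDefinedOver_kLocus K _).isZariskiClosed
  have hSclosed : IsClosedInG F (r + n)
      (linSlice (r + n) F W A (fun i => (kv i : F)) ∩ cosetU (r + n) F (ζ ∘ Sum.inr) M) :=
    isClosedInG_linSlice_inter_cosetU hWclosed A _ (fun i => hζT i) M
  obtain ⟨X', hX'comp, hXX'⟩ :=
    exists_isIrredComponentInG_superset hSclosed hXirr (subset_inter hXslice hXcoset)
  have hζX' : ζ ∈ X' := hXX' hζX₁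
  /- dimensions -/
  obtain ⟨d𝔭, hd𝔭, hd𝔭le⟩ :=
    exists_ringKrullDim_quotient_kLocIdeal_le (K := K) (a := a) hirr hne hdim hdef
  have htfin : (algMatroid F).relRank (K₀ : Set F) Sa < ⊤ :=
    (algMatroid F).relRank_lt_top_of_finite _ ((finite_range _).subset sdiff_subset)
  obtain ⟨t, ht⟩ := ENat.ne_top_iff_exists.1 htfin.ne
  obtain ⟨dZ, hdZ, hdZrel⟩ := exists_ringKrullDim_quotient_vanishingIdeal_singleton K₀ ζ
  have hlow := relRank_gammaPt_add_le K a g hX hldimg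
  have hdZlow : t + (n - s) ≤ dZ := by
    have : (t : ℕ∞) + ((n - s : ℕ) : ℕ∞) ≤ (dZ : ℕ∞) := by
      rw [ht, hdZrel]; exact hlow
    exact_mod_cast this
  have hd𝔭le' : d𝔭 ≤ t + n := by
    have : (d𝔭 : ℕ∞) ≤ (t : ℕ∞) + n := by rw [ht]; exact hd𝔭le
    exact_mod_cast this
  -- `dim X' ≥ dZ`
  have hdimX : ((dZ : ℕ) : WithBot ℕ∞) ≤ zariskiDim F X' := by
    have h1 : zariskiDim F X₁ = zariskiDim F Xc := by
      rw [hX₁]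
      refine zariskiDim_inter_torusLocus ?_ ⟨ζ, hζQ, hζT⟩
      rw [hXc, MvPolynomial.IsPrime.vanishingIdeal_zeroLocus Q]; exact hQp
    have h2 : zariskiDim F Xc = dZ := by
      rw [hXc, LocusComponents.zariskiDim_component hQ, hdZ]
    rw [← h2, ← h1]
    exact zariskiDim_mono hXX'
  -- `dim U + 1 ≤ d𝔭`: a non-zero row of `M` gives a form outside `𝔭` vanishing on `U`
  obtain ⟨i₀, hi₀⟩ : ∃ i, M i ≠ 0 := by
    by_contra hall
    push Not at hall
    exact hM0 (Matrix.ext fun i j => by rw [hall i]; rfl)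
  have hℓ𝔭 : rowForm K₀ M kv i₀ ∉ 𝔭 := by
    intro hmem
    rw [h𝔭def, mem_kLocIdeal_iff] at hmem
    have hval : ∀ v ∈ V, (∑ j : Fin r, (M i₀ (Fin.castAdd n j) : F) * a j) +
        ∑ j : Fin n, (M i₀ (Fin.natAdd r j) : F) * v (Sum.inl j) = (kv i₀ : F) := by
      intro v hv
      have := hmem v hv
      rw [aeval_rowForm, sub_eq_zero, Fin.sum_univ_add] at this
      simpa [prodPt_inl, Fin.append_left, Fin.append_right] using this
    by_cases hVpart : (fun j : Fin n => M i₀ (Fin.natAdd r j)) = 0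
    · have hApart : (fun j : Fin r => M i₀ (Fin.castAdd n j)) ≠ 0 := by
        intro h0
        apply hi₀
        funext j
        refine Fin.addCases (fun j' => ?_) (fun j' => ?_) j
        · exact congrFun h0 j'
        · exact congrFun hVpart j'
      obtain ⟨v, hv⟩ := hne
      have h1 := hval v hv
      have h2 : ∑ j : Fin n, (M i₀ (Fin.natAdd r j) : F) * v (Sum.inl j) = 0 :=
        Finset.sum_eq_zero fun j _ => by
          rw [show M i₀ (Fin.natAdd r j) = 0 from congrFun hVpart j]; simp
      rw [h2, add_zero] at h1
      have hmemK : ∑ j : Fin r, ((M i₀ (Fin.castAdd n j) : ℤ) : ℚ) • a j ∈ K := by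
        have : ∑ j : Fin r, ((M i₀ (Fin.castAdd n j) : ℤ) : ℚ) • a j =
            ∑ j : Fin r, (M i₀ (Fin.castAdd n j) : F) * a j :=
          Finset.sum_congr rfl fun j _ => by rw [Rat.smul_def, Rat.cast_intCast]
        rw [this, h1]
        exact (hK.mem_fieldOf_iff).1 (kv i₀).2
      have hq := ha _ hmemK
      apply hApart
      funext j
      have hj := congrFun hq j
      simp only [Pi.zero_apply, Int.cast_eq_zero] at hj
      exact hj
    · refine hadd _ hVpart ⟨(kv i₀ : F) - ∑ j : Fin r, (M i₀ (Fin.castAdd n j) : F) * a j,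
        fun v hv => ?_⟩
      rw [← hval v hv]
      ring
  have hslice : zariskiDim F (linSlice (r + n) F W A (fun i => (kv i : F))) + 1 ≤ (d𝔭 : WithBot ℕ∞) :=
    zariskiDim_add_one_le_of_notMem hd𝔭 (fun z hz => hz.1) hℓ𝔭
      (fun z hz => by rw [aeval_rowForm, sub_eq_zero, ← hAmul, hz.2.2])
  -- atypicality of `X'`
  have hatyp : zariskiDim F (linSlice (r + n) F W A (fun i => (kv i : F))) +
      (((r + n) - (M.map (Int.cast : ℤ → ℚ)).rank : ℕ) : WithBot ℕ∞) <
        zariskiDim F X' + ((r + n : ℕ) : WithBot ℕ∞) := by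
    rw [hrank]
    exact WithBot.add_lt_add_of_bounds hslice hdimX (by omega)
  /- the weak Zilber–Pink bound -/
  obtain ⟨MH, hMH𝓗, hX'cos, hstar⟩ :=
    h𝓗 A (fun i => (kv i : F)) M (ζ ∘ Sum.inr) X' (fun i => hζT i) hX'comp hatyp ζ hζX'
  refine ⟨MH, hMH𝓗, ?_⟩
  /- the rows of `M_H` are relations of `ζ₁` over `K` (Γ-closedness of `K`) -/
  have hrowK : ∀ i, ∑ j, (MH i j : F) * ζ (Sum.inl j) ∈ K := by
    intro i
    set u : F := ∏ j, ζ (Sum.inr j) ^ MH i j with hu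
    have hu' : ∀ z ∈ zeroLocus F Q ∩ torusLocus F (r + n), ∏ j, z (Sum.inr j) ^ MH i j = u := by
      intro z hz
      have hzcos := hX'cos (hXX' hz)
      exact (prod_div_zpow_eq_one_iff_prod_eq (fun i => hζT i) (MH i)).1
        (hzcos.2 (MH i) (row_mem_rowSat MH i))
    obtain ⟨c, hc⟩ := LocusComponents.mem_range_of_prod_zpow_eq_const hQ hY𝔯 (MH i) u hu'
    have huexp : u = exp (∑ j, (MH i j : F) * ζ (Sum.inl j)) := by
      rw [hu]; exact prod_gammaPt_inr_zpow _ _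
    apply hK.mem_of_exp_mem_acl
    rw [← huexp, ← hc]
    exact fieldOf_subset_acl K c.2
  have hrowspan : ∀ i, (MH.map (Int.cast : ℤ → ℚ)) i ∈
      Submodule.span ℚ (Set.range (M.map (Int.cast : ℤ → ℚ)).row) := by
    intro i
    refine mem_span_rows_of_isRelation K (Fin.append a g) hrank hrel hldimζ ?_
    have : ∑ j, (((MH.map (Int.cast : ℤ → ℚ)) i j : ℚ) : F) * Fin.append a g j =
        ∑ j, (MH i j : F) * ζ (Sum.inl j) :=
      Finset.sum_congr rfl fun j _ => by simp [Matrix.map_apply, hζ1]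
    rw [this]
    exact hrowK i
  have hrankHM : ((Matrix.fromRows MH M).map (Int.cast : ℤ → ℚ)).rank = s := by
    rw [rank_fromRows_eq_of_mem_span hrowspan, hrank]
  -- `[M_H] ζ` is `K₀`-rational
  have hMHζ : matrixAct MH ζ = gammaPt fun i => ∑ j, (MH i j : F) * Fin.append a g j :=
    matrixAct_gammaPt (Fin.append a g) MH
  have hrat : ∀ j, matrixAct MH ζ j ∈ Set.range (algebraMap K₀ F) := by
    intro j
    rw [hMHζ]
    rcases j with i | i
    · exact ⟨⟨_, mem_fieldOf_of_mem (hrowK i)⟩, rfl⟩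
    · exact ⟨⟨_, exp_mem_fieldOf (hrowK i)⟩, rfl⟩
  -- `U ∩ (𝔾ₐ × ζ₂·(ker M_H)°)` lies in the fibre of `[M_H]` through `ζ`
  set Φ : Set (Fin (r + n) ⊕ Fin (r + n) → F) :=
    {w | w ∈ zeroLocus F 𝔭 ∩ torusLocus F (r + n) ∧ matrixAct MH w = matrixAct MH ζ} with hΦ
  have hsub : linSlice (r + n) F W A (fun i => (kv i : F)) ∩ cosetU (r + n) F (ζ ∘ Sum.inr) MH ⊆ Φ := by
    rintro w ⟨⟨hwW, hwT, hAw⟩, -, hcos⟩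
    refine ⟨⟨hwW, hwT⟩, ?_⟩
    funext j
    rcases j with i | i
    · rw [matrixAct_inl, matrixAct_inl]
      obtain ⟨c, hc⟩ := (Submodule.mem_span_range_iff_exists_fun ℚ).1 (hrowspan i)
      have hcoef : ∀ j, (MH i j : F) = ∑ l, (c l : F) * (M l j : F) := by
        intro j
        have h' := congrFun hc j
        simp only [Finset.sum_apply, Pi.smul_apply, smul_eq_mul, Matrix.row, Matrix.map_apply] at h'
        have h'' := congrArg (fun q : ℚ => (q : F)) h'
        simp only [Rat.cast_sum, Rat.cast_mul, Rat.cast_intCast] at h''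
        exact h''.symm
      have key : ∀ z : Fin (r + n) ⊕ Fin (r + n) → F,
          A.mulVec (z ∘ Sum.inl) = (fun i => (kv i : F)) →
            ∑ j, (MH i j : F) * z (Sum.inl j) = ∑ l, (c l : F) * (kv l : F) := by
        intro z hz
        calc ∑ j, (MH i j : F) * z (Sum.inl j)
            = ∑ j, (∑ l, (c l : F) * (M l j : F)) * z (Sum.inl j) := by
              refine Finset.sum_congr rfl fun j _ => ?_
              rw [hcoef j]
          _ = ∑ l, (c l : F) * ∑ j, (M l j : F) * z (Sum.inl j) := by
              simp_rw [Finset.sum_mul, Finset.mul_sum, mul_assoc]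
              rw [Finset.sum_comm]
          _ = ∑ l, (c l : F) * (kv l : F) := by
              refine Finset.sum_congr rfl fun l _ => ?_
              rw [← hAmul z l, hz]
      rw [key w hAw, key ζ hAζ]
    · rw [matrixAct_inr, matrixAct_inr]
      exact (prod_div_zpow_eq_one_iff_prod_eq (fun i => hζT i) (MH i)).1
        (hcos (MH i) (row_mem_rowSat MH i))
  /- the count -/
  by_contra hcontra
  rw [hrankHM] at hstar
  set sH : ℕ := (MH.map (Int.cast : ℤ → ℚ)).rank with hsH
  -- the slice has finite dimension `sl` with `sl + 1 ≤ d𝔭`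
  have hsl0 : 0 ≤ zariskiDim F (linSlice (r + n) F W A (fun i => (kv i : F))) :=
    zariskiDim_nonneg_of_nonempty ⟨ζ, hζslice⟩
  have h01 : (0 : WithBot ℕ∞) ≤ 1 := by exact_mod_cast (zero_le_one : (0 : ℕ∞) ≤ 1)
  obtain ⟨sl, hsl, -⟩ := WithBot.exists_nat_eq_of_le hsl0 (d := d𝔭)
    (le_trans (le_add_of_nonneg_right h01) hslice)
  have hsl1 : sl + 1 ≤ d𝔭 := by
    rw [hsl] at hslice; exact_mod_cast hslice
  by_cases hMH0 : MH = 0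
  · -- `M_H = 0`: the bound says `dim X' + s ≤ dim U`
    have hsH0 : sH = 0 := by
      rw [hsH, hMH0, Matrix.map_zero (Int.cast : ℤ → ℚ) Int.cast_zero]; exact Matrix.rank_zero
    rw [hsH0] at hstar
    have h1 : ((dZ + s : ℕ) : WithBot ℕ∞) ≤ ((sl : ℕ) : WithBot ℕ∞) := by
      calc ((dZ + s : ℕ) : WithBot ℕ∞) = (dZ : WithBot ℕ∞) + (s : WithBot ℕ∞) := by push_cast; rfl
        _ ≤ zariskiDim F X' + (s : WithBot ℕ∞) := add_le_add hdimX le_rfl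
        _ ≤ zariskiDim F (linSlice (r + n) F W A (fun i => (kv i : F)) ∩
              cosetU (r + n) F (ζ ∘ Sum.inr) MH) + ((0 : ℕ) : WithBot ℕ∞) := hstar
        _ ≤ zariskiDim F (linSlice (r + n) F W A (fun i => (kv i : F))) + 0 :=
            add_le_add (zariskiDim_mono inter_subset_left) le_rfl
        _ = sl := by rw [hsl, add_zero]
    have h2 : dZ + s ≤ sl := by exact_mod_cast h1
    omega
  · -- `M_H ≠ 0`: strong rotundity of `W` and the fibre-dimension bound
    have hfb := hfib MH ζ ⟨hζW, hζT⟩ hrat hcontra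
    rw [hd𝔭] at hfb
    have hΦne : Φ.Nonempty := ⟨ζ, ⟨hζW, hζT⟩, rfl⟩
    set Im : Set (Fin (r + n) ⊕ Fin (r + n) → F) :=
      matrixAct MH '' (zeroLocus F 𝔭 ∩ torusLocus F (r + n)) with hIm
    have hImne : Im.Nonempty := ⟨_, ζ, ⟨hζW, hζT⟩, rfl⟩
    have hΦ0 := zariskiDim_nonneg_of_nonempty hΦne
    have hIm0 := zariskiDim_nonneg_of_nonempty hImne
    have hΦle : zariskiDim F Φ ≤ d𝔭 := le_trans (le_add_of_nonneg_right hIm0) hfb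
    have hImle : zariskiDim F Im ≤ d𝔭 := le_trans (le_add_of_nonneg_left hΦ0) hfb
    obtain ⟨φn, hφn, -⟩ := WithBot.exists_nat_eq_of_le hΦ0 hΦle
    obtain ⟨imn, himn, -⟩ := WithBot.exists_nat_eq_of_le hIm0 hImle
    rw [hφn, himn] at hfb
    have hsum : φn + imn ≤ d𝔭 := by exact_mod_cast hfb
    have hstar' : ((dZ + s : ℕ) : WithBot ℕ∞) ≤ ((φn + sH : ℕ) : WithBot ℕ∞) := by
      have h1 : zariskiDim F (linSlice (r + n) F W A (fun i => (kv i : F)) ∩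
          cosetU (r + n) F (ζ ∘ Sum.inr) MH) ≤ φn := by
        rw [← hφn]; exact zariskiDim_mono hsub
      calc ((dZ + s : ℕ) : WithBot ℕ∞) = (dZ : WithBot ℕ∞) + (s : WithBot ℕ∞) := by push_cast; rfl
        _ ≤ zariskiDim F X' + (s : WithBot ℕ∞) := add_le_add hdimX le_rfl
        _ ≤ zariskiDim F (linSlice (r + n) F W A (fun i => (kv i : F)) ∩
              cosetU (r + n) F (ζ ∘ Sum.inr) MH) + (sH : WithBot ℕ∞) := hstar
        _ ≤ (φn : WithBot ℕ∞) + (sH : WithBot ℕ∞) := add_le_add h1 le_rfl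
        _ = ((φn + sH : ℕ) : WithBot ℕ∞) := by push_cast; rfl
    have hstar'' : dZ + s ≤ φn + sH := by exact_mod_cast hstar'
    have hsrotH := hsrot MH hMH0
    have hIm1 : ((sH + 1 : ℕ) : WithBot ℕ∞) ≤ zariskiDim F Im :=
      WithBot.natCast_add_one_le_of_lt hsrotH
    rw [himn] at hIm1
    have hIm2 : sH + 1 ≤ imn := by exact_mod_cast hIm1
    omega

end Core

/-! ### GSΓC for a pair `(V, α)` from GΓC and the weak Zilber–Pink bound -/

section Main

variable {F : Type u} [Field F] [CharZero F] [Literature.ModelTheory.ExponentialFields.ExponentialRing F]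
  [IsAlgClosed F]

/-- **Bays–Kirby 2018, Prop. 11.5 for one pair `(V, α)`, from the weak Zilber–Pink bound.** Let
`K ◁_cl F` be Γ-closed (`F` algebraically closed) and let `V = W₀ ∩ Gⁿ`, `α = (a, exp a)` be as in
Def. 11.1 (`V` irreducible of dimension `n`, additively free, defined over `K(α)`; `a` linearly
independent over `K`, `K + ℚa ◁ F`; `W = Loc(α, V/K)` strongly rotund). Assume the Γ-points of `V`
are Zariski dense in `V` (the conclusion of GΓC for `V`) and that a finite set `𝓗` of integer
matrices controls the atypical components of the linear slices of `W` (`WeakZPBound`, the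
conclusion of Thm 11.4 for the family `U_{M,c} = W ∩ (Λ_{M,c} × 𝔾ₘ^{r+n})`). Then some Γ-point
`(g, exp g) ∈ V` has `g` linearly independent over `K + ℚa`. Proof (Bays–Kirby, proof of
Prop. 11.5): for each `H` the fibre-dimension theorem gives a proper `K₀`-closed `W_H ⊂ W`
(`MonomialFibre.exists_fibre_dimension_bound`), and since `α` is generic in the projection of `W`,
`V_{H,α} = {y ∈ V | (α, y) ∈ W_H}` is cut out in `V` by a polynomial `f_H ∉ I(V)`; every dependent
Γ-point of `V` lies in some `V_{H,α}`, `H ∈ 𝓗` (`exists_mem_aeval_matrixAct_eq_zero`); by density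
there is a Γ-point of `V` avoiding the zeros of `∏_H f_H`.
[cite: BaysKirby2018ANT, Prop. 11.5 (proof)] -/
theorem exists_gammaPt_linIndepOver_of_weakZPBound {K : Submodule ℚ F} (hK : IsGammaClosed K)
    {n r : ℕ} {W₀ : Set (Fin n ⊕ Fin n → F)} {a : Fin r → F}
    (hirr : IsIrreducibleClosed F W₀) (hne : (W₀ ∩ torusLocus F n).Nonempty)
    (hdim : zariskiDim F W₀ = n) (hadd : IsAddFree F n (W₀ ∩ torusLocus F n))
    (ha : LinIndepOver K a) (hX : IsStrong (K ⊔ Submodule.span ℚ (range a)))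
    (hdef : IsDefinedOver (adjoinPt K a) W₀)
    (hsrot : IsStronglyRotund F (r + n)
      (locOver K (gammaPt a) (W₀ ∩ torusLocus F n) ∩ torusLocus F (r + n)))
    (hdense : vanishingIdeal F (W₀ ∩ expGraph F n) ≤ vanishingIdeal F W₀)
    {𝓗 : Finset (Matrix (Fin (r + n)) (Fin (r + n)) ℤ)}
    (h𝓗 : WeakZPBound F (r + n) (locOver K (gammaPt a) (W₀ ∩ torusLocus F n)) 𝓗) :
    ∃ g : Fin n → F, gammaPt g ∈ W₀ ∧ LinIndepOver (K ⊔ Submodule.span ℚ (range a)) g := by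
  classical
  set K₀ : Subfield F := (fieldOf K).toSubfield with hK₀
  set 𝔭 := kLocIdeal K a W₀ with h𝔭def
  haveI h𝔭 : 𝔭.IsPrime := isPrime_kLocIdeal hirr hne
  have hY : ∀ i, (X (Sum.inr i) : MvPolynomial (Fin (r + n) ⊕ Fin (r + n)) K₀) ∉ 𝔭 :=
    X_inr_notMem_kLocIdeal hne
  -- the fibre polynomials `h_H`
  have hfibre := fun MH : Matrix (Fin (r + n)) (Fin (r + n)) ℤ =>
    MonomialFibre.exists_fibre_dimension_bound (P := 𝔭) (F := F) hY MH
  choose hh hwit hfib using hfibre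
  -- the polynomials `f_H` over `F` cutting out `V_{H,α}` in `V`
  have hf : ∀ MH : Matrix (Fin (r + n)) (Fin (r + n)) ℤ, ∃ f : MvPolynomial (Fin n ⊕ Fin n) F,
      f ∉ vanishingIdeal F W₀ ∧ ∀ g : Fin n → F,
        aeval (matrixAct MH (gammaPt (Fin.append a g))) (hh MH) = 0 → aeval (gammaPt g) f = 0 := by
    intro MH
    obtain ⟨N', b, hb⟩ := exists_mul_prod_pow_eq_aeval MH (hh MH)
    obtain ⟨w, ⟨hw𝔭, hwT⟩, hw⟩ := hwit MH
    have hb𝔭 : b ∉ 𝔭 := by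
      intro hmem
      have h1 : aeval w b = 0 := (mem_zeroLocus_iff.1 hw𝔭) b hmem
      rw [← hb w hwT] at h1
      exact (mul_ne_zero hw (pow_ne_zero _ (Finset.prod_ne_zero_iff.2 fun i _ => hwT i))) h1
    have hv : ∃ v ∈ W₀ ∩ torusLocus F n, aeval (prodPt (gammaPt a) v) b ≠ 0 := by
      by_contra hall
      push Not at hall
      exact hb𝔭 (mem_kLocIdeal_iff.2 hall)
    obtain ⟨v, hv, hvb⟩ := hv
    refine ⟨substPt (k := K₀) (E := F) (n := n) (gammaPt a) b, ?_, ?_⟩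
    · intro hmem
      apply hvb
      have := (mem_vanishingIdeal_iff.1 hmem) v hv.1
      rw [aeval_substPt] at this
      exact this
    · intro g hg0
      rw [aeval_substPt]
      change aeval (prodPt (gammaPt a) (gammaPt g)) b = 0
      rw [prodPt_gammaPt, ← hb _ (gammaPt_mem_torusLocus _), hg0, zero_mul]
  choose f hfI hfzero using hf
  -- a Γ-point of `V` avoiding the zeros of `∏_{H ∈ 𝓗} f_H`
  have hprodI : (∏ MH ∈ 𝓗, f MH) ∉ vanishingIdeal F W₀ := by
    intro hmem
    haveI := hirr.2
    obtain ⟨MH, -, hMH⟩ := Ideal.IsPrime.prod_mem_iff.1 hmem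
    exact hfI MH hMH
  have hprodΓ : (∏ MH ∈ 𝓗, f MH) ∉ vanishingIdeal F (W₀ ∩ expGraph F n) := fun h => hprodI (hdense h)
  rw [mem_vanishingIdeal_iff] at hprodΓ
  push Not at hprodΓ
  obtain ⟨ξ, ⟨hξW, hξexp⟩, hξ⟩ := hprodΓ
  set g : Fin n → F := ξ ∘ Sum.inl with hg
  have hξg : ξ = gammaPt g := (mem_expGraph_iff_eq_gammaPt ξ).1 hξexp
  rw [hξg] at hξW hξ
  refine ⟨g, hξW, ?_⟩
  by_contra hdep
  obtain ⟨MH, hMH, h0⟩ := exists_mem_aeval_matrixAct_eq_zero hK hirr hne hdim hadd ha hX hdef hsrot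
    h𝓗 hh hfib hξW hdep
  apply hξ
  rw [map_prod]
  exact Finset.prod_eq_zero hMH (hfzero MH g h0)

/-- **GΓC over `K` ⟹ GSΓC over `K`, given the weak Zilber–Pink bounds** (Bays–Kirby 2018,
Prop. 11.5, exponential case, for `K ◁_cl F` Γ-closed and `F` algebraically closed): if every
`K`-locus has its atypical slice components controlled by finitely many subgroups (the conclusion
of Thm 11.4 for every Zariski closed `W ⊆ F^{N ⊕ N}`), then generic Γ-closedness over `K` implies
generic strong Γ-closedness over `K`. [cite: BaysKirby2018ANT, Prop. 11.5] -/
theorem isGenericallyStronglyGammaClosedOver_of_weakZP {K : Submodule ℚ F} (hK : IsGammaClosed K)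
    (hZP : ∀ (N : ℕ) (W : Set (Fin N ⊕ Fin N → F)), IsZariskiClosed F W →
      ∃ 𝓗 : Finset (Matrix (Fin N) (Fin N) ℤ), WeakZPBound F N W 𝓗)
    (hG : IsGenericallyGammaClosedOver K) : IsGenericallyStronglyGammaClosedOver K := by
  intro n r W₀ a hirr hne hdim hadd hmul hrot ha hX hdef hsrot
  obtain ⟨𝓗, h𝓗⟩ := hZP (r + n) (locOver K (gammaPt a) (W₀ ∩ torusLocus F n))
    (isDefinedOver_kLocus K _).isZariskiClosed
  exact exists_gammaPt_linIndepOver_of_weakZPBound hK hirr hne hdim hadd ha hX hdef hsrot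
    (hG n r W₀ a hirr hne hdim hadd hmul hrot ha hX hdef hsrot) h𝓗

end Main

end GammaField

/-! ### Prop. 11.5 from the horizontal weak Zilber–Pink theorem -/

open GammaField in
/-- **Bays–Kirby 2018, Prop. 11.5 (GΓC over `K` ⟹ GSΓC over `K`) from the horizontal semiabelian
weak Zilber–Pink theorem.** The hypothesis is Bays–Kirby's Theorem 11.4 for `S = 𝔾ₘᴺ`,
`U = 𝔾ₐᴺ` and the family of linear slices `U_{M,c} = W ∩ (Λ_{M,c} × 𝔾ₘᴺ)` of a Zariski closed
`W` over an algebraically closed field of characteristic zero, in the form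
`Literature.NumberTheory.Transcendental.WeakZPBound` (connected algebraic subgroups of `𝔾ₘᴺ`
presented as `(ker M)°` by integer matrices, Lemma 2.1); it rests on the uniform weak CIT
(Fact 11.3: Zilber 2002; Kirby 2009, Thm 4.6) and is the deep input of Prop. 11.5. Given it, the
named fact `Literature.NumberTheory.Transcendental.BaysKirby2018_prop_11_5` follows
(`GammaField.isGenericallyStronglyGammaClosedOver_of_weakZP`; neither `K ≠ F` nor the
surjectivity of `exp` is needed). [cite: BaysKirby2018ANT, Prop. 11.5, Thm 11.4] -/
theorem BaysKirby2018_prop_11_5_of_weakZP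
    (hZP : ∀ {F : Type u} [Field F] [CharZero F], IsAlgClosed F →
      ∀ (N : ℕ) (W : Set (Fin N ⊕ Fin N → F)), IsZariskiClosed F W →
        ∃ 𝓗 : Finset (Matrix (Fin N) (Fin N) ℤ), WeakZPBound F N W 𝓗) :
    BaysKirby2018_prop_11_5.{u} := by
  intro F _ _ _ hF _ K hKΓ _ hG
  haveI := hF
  exact isGenericallyStronglyGammaClosedOver_of_weakZP hKΓ (fun N W hW => hZP hF N W hW) hG

end Literature.NumberTheory.Transcendental
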